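import Literature.MathematicalPhysics.QuantumFieldTheory.LatticeGaugeShenZhuZhuProofs
import Literature.MathematicalPhysics.QuantumFieldTheory.LatticeGaugeDobrushinPoincare
import Literature.MathematicalPhysics.QuantumFieldTheory.LatticeGaugeTorusAreaLaw
import Literature.MathematicalPhysics.QuantumFieldTheory.Sweep1AreaLawProofs
import Literature.MathematicalPhysics.QuantumFieldTheory.Sweep1Proofs
import HarnessLib

/-!
# Shen–Zhu–Zhu (S16) in the vocabulary of `Sweep1`: reduction to the DLR fact `shen_zhu_zhu`


Sibling proof file of `Literature/MathematicalPhysics/QuantumFieldTheory/Sweep1.lean`. It proves,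
sorry-free and without introducing any definition or named fact (D-0026),

  `theorem shenZhuZhu_strongCoupling_of_shen_zhu_zhu :
      shen_zhu_zhu d N → shenZhuZhu_strongCoupling (d := d) ρ`

for every `SU(N)` model `(G, ρ)` (`IsSpecialUnitaryModel ρ`): the named fact
`Literature.MathematicalPhysics.QuantumFieldTheory.shenZhuZhu_strongCoupling` of `Sweep1`
(Shen–Zhu–Zhu, CMP 400 (2023) 805, arXiv:2204.12737, Thm. 1.2, Rem. 1.3 and Cor. 1.6 "mass gap",
in the periodic / free-boundary vocabulary of `Sweep1`) follows from the named fact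
`Literature.MathematicalPhysics.QuantumFieldTheory.shen_zhu_zhu` of `LatticeGauge` (the same
theorem in the DLR vocabulary of A9 `LatticeGaugeDLR`), whose proof the tree has already reduced
to the one-link Poincaré inequality on `SU(N)` (`shen_zhu_zhu_of_haarPoincare`).

## The bridge

* `periodicState = torusState` (`Sweep1`'s periodisation `ofTorus` is A9's `torusLift`).
* Free-boundary infinite-volume limits (`Sweep1.IsInfiniteVolumeLimit`) are DLR states of
  `ymSpecification ρ β` (`mem_ymGibbsMeasures_of_isInfiniteVolumeLimit`): the free-boundary
  measure on a box satisfies the DLR equation of every edge set `Δ` whose plaquettes lie in the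
  box (`integral_zdWilsonMeasure_eq_integral_integral_ymSpecification`, from a resampling
  identity for the infinite Haar product, `map_glueWith_zdHaar_prod_pi`), and the kernels are
  Feller (A9 `continuous_integral_ymSpecification`); Georgii 2011 Thm. 4.17, Friedli–Velenik
  2017 Thm. 6.26 / Exercise 6.14 (free boundary conditions).
* DLR uniqueness and "torus limit points are DLR" (A9
  `mem_ymGibbsMeasures_of_mem_infiniteVolumeLimitPoints_holds`) give convergence of the full
  sequence of torus states on all bounded continuous functions, by compactness of the space of
  probability measures (`tendsto_integral_torusState_of_subsingleton`), and translation
  invariance of the limit (`map_configShift_eq_of_tendsto_torusState`).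
* For the concrete group `Matrix.specialUnitaryGroup (Fin N) ℂ` the plaquette observables are
  Lipschitz cylinder functions, so conjunct (ii) of `shen_zhu_zhu` gives the exponential decay
  of plaquette–plaquette covariances (`ℓ^∞` edge-set distance versus Euclidean distance of base
  points costs a factor `√d` in the rate).
* An abstract `SU(N)` model `(G, ρ)` is isomorphic to the concrete one as a compact group
  (`IsSpecialUnitaryModel`); every object of the statement is transported along the induced
  equivalence of configuration spaces (push-forward of Haar and of the infinite Haar product).

## References

* H. Shen, R. Zhu, X. Zhu, *A stochastic analysis approach to lattice Yang–Mills at strong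
  coupling*, CMP 400 (2023) 805–851, arXiv:2204.12737, Assumption 1.1, Thm. 1.2, Rem. 1.3,
  Cor. 1.6.
* H.-O. Georgii, *Gibbs Measures and Phase Transitions*, 2nd ed. (2011), Thm. 4.17.
* S. Friedli, Y. Velenik, *Statistical Mechanics of Lattice Systems* (2017), Thm. 6.26,
  Lemma 6.30, Exercise 6.14.
-/

noncomputable section

open MeasureTheory Filter Topology ProbabilityTheory
open scoped ENNReal NNReal BoundedContinuousFunction
open Literature.Probability.LatticeModels (box glueWith glueWith_apply_mem
  glueWith_apply_not_mem measurable_glueWith)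
open Literature.MathematicalPhysics.QuantumLattice (LGConfig torusLift torusEdge toTorusObservable
  configShift configShift_apply ymSpecification ymGibbsMeasures plaquettesTouching plaquetteEdges
  ZdPlaquette mem_plaquettesTouching_iff wilsonBoundaryAction plaquetteObs plaquetteHolonomyZd
  IsCylinder infiniteVolumeLimitPoints IsInfiniteVolumeLimitAlong fundamentalRep fundamentalRep_apply
  continuous_fundamentalRep fundamentalRep_mem_unitaryGroup)

namespace Literature.MathematicalPhysics.QuantumFieldTheory

/-! ### `Sweep1`'s periodic states are A9's torus states -/

section Periodic

variable {d N : ℕ} {G : Type*} [Group G] [TopologicalSpace G] [IsTopologicalGroup G]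
  [CompactSpace G] [MeasurableSpace G] [BorelSpace G] (ρ : G →* Matrix (Fin N) (Fin N) ℂ)

omit [Group G] [TopologicalSpace G] [IsTopologicalGroup G] [CompactSpace G] [MeasurableSpace G]
  [BorelSpace G] in
/-- `Sweep1`'s periodisation `ofTorus` is A9's periodic lift `torusLift`. [folklore] -/
theorem ofTorus_eq_torusLift (L : ℕ) :
    (ZdGaugeConfig.ofTorus : GaugeConfig d L G → ZdGaugeConfig d G) = torusLift L := rfl

/-- `Sweep1`'s periodic state is the torus Wilson state transported to `ℤ^d`
(`LatticeGaugeProofs.torusState`). [folklore] -/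
theorem periodicState_eq_torusState (β : ℝ) (L : ℕ) [NeZero L] :
    periodicState (d := d) ρ β L = torusState ρ β L := rfl

omit [Group G] [TopologicalSpace G] [IsTopologicalGroup G] [CompactSpace G] [MeasurableSpace G]
  [BorelSpace G] in
/-- `Sweep1`'s lattice translation `translate a` is A9's `configShift (-a)`. [folklore] -/
theorem translate_eq_configShift [MeasurableSpace G] (a : Literature.Probability.LatticeModels.Site d) :
    (ZdGaugeConfig.translate a : ZdGaugeConfig d G → ZdGaugeConfig d G) = configShift (-a) := by
  funext U e
  simp [ZdGaugeConfig.translate, configShift_apply, sub_neg_eq_add]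

end Periodic

/-! ### A resampling identity for the infinite Haar product -/

section Resampling

variable {d : ℕ} {G : Type*} [Group G] [TopologicalSpace G] [IsTopologicalGroup G]
  [CompactSpace G] [MeasurableSpace G] [BorelSpace G]

/-- **Resampling identity for the infinite Haar product.** If `η` is `dg_∞`-distributed and
`ζ ∈ G^Δ` is an independent Haar sample, then the glued configuration `ζ η_{Δᶜ}` is again
`dg_∞`-distributed (checked on measurable boxes, Mathlib `Measure.eq_infinitePi`). [folklore] -/
theorem map_glueWith_zdHaar_prod_pi (Δ : Finset (ZdEdge d)) :
    ((zdHaar d G).prod (Measure.pi fun _ : ↥Δ => haarProbability G)).map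
        (fun p => glueWith Δ p.2 p.1) = zdHaar d G := by
  classical
  set π : Measure (↥Δ → G) := Measure.pi fun _ : ↥Δ => haarProbability G with hπ
  unfold zdHaar
  refine Measure.eq_infinitePi _ fun s t ht => ?_
  rw [Measure.map_apply (QuantumLattice.measurable_glueWith_prod Δ)
    (MeasurableSet.pi s.countable_toSet fun i _ => ht i)]
  have hpre : (fun p : ZdGaugeConfig d G × (↥Δ → G) => glueWith Δ p.2 p.1) ⁻¹'
      (↑s : Set (ZdEdge d)).pi t =
      ((↑(s.filter (· ∉ Δ)) : Set (ZdEdge d)).pi t) ×ˢ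
        ((↑(s.subtype (· ∈ Δ)) : Set ↥Δ).pi fun j => t j) := by
    ext p
    simp only [Set.mem_preimage, Set.mem_pi, Finset.mem_coe, Set.mem_prod, Finset.mem_filter,
      Finset.mem_subtype]
    constructor
    · intro h
      refine ⟨fun i hi => ?_, fun j hj => ?_⟩
      · have := h i hi.1
        rwa [glueWith_apply_not_mem _ _ _ hi.2] at this
      · have := h j hj
        rwa [glueWith_apply_mem _ _ _ j.2] at this
    · rintro ⟨h1, h2⟩ i hi
      by_cases hiΔ : i ∈ Δ
      · rw [glueWith_apply_mem _ _ _ hiΔ]; exact h2 ⟨i, hiΔ⟩ hi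
      · rw [glueWith_apply_not_mem _ _ _ hiΔ]; exact h1 i ⟨hi, hiΔ⟩
  have hfin : π (((↑(s.subtype (· ∈ Δ)) : Set ↥Δ).pi fun j => t j)) =
      ∏ i ∈ s.filter (· ∈ Δ), haarProbability G (t i) := by
    rw [← Set.univ_pi_ite, hπ, Measure.pi_pi]
    simp only [apply_ite, measure_univ, Finset.mem_coe]
    rw [Finset.prod_ite_mem, Finset.univ_inter]
    exact Finset.prod_subtype_eq_prod_filter (f := fun i => haarProbability G (t i))
  rw [hpre, Measure.prod_prod, Measure.infinitePi_pi _ (fun i _ => ht i), hfin, mul_comm,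
    Finset.prod_filter_mul_prod_filter_not]

/-- Integral form of the resampling identity: `∫ Φ dg_∞ = ∫∫ Φ(ζ η_{Δᶜ}) dζ dg_∞(η)` for a
bounded measurable `Φ`. [folklore] -/
theorem integral_zdHaar_eq_integral_integral_glueWith (Δ : Finset (ZdEdge d))
    {Φ : ZdGaugeConfig d G → ℝ} (hΦm : Measurable Φ) {C : ℝ} (hC : ∀ U, |Φ U| ≤ C) :
    ∫ U, Φ U ∂(zdHaar d G) =
      ∫ η, ∫ ζ, Φ (glueWith Δ ζ η) ∂(Measure.pi fun _ : ↥Δ => haarProbability G)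
        ∂(zdHaar d G) := by
  have hmap := map_glueWith_zdHaar_prod_pi (d := d) (G := G) Δ
  have hg := QuantumLattice.measurable_glueWith_prod (d := d) (G := G) Δ
  have hint : Integrable (fun p : ZdGaugeConfig d G × (↥Δ → G) => Φ (glueWith Δ p.2 p.1))
      ((zdHaar d G).prod (Measure.pi fun _ : ↥Δ => haarProbability G)) :=
    QuantumLattice.integrable_of_bound (hΦm.comp hg).aestronglyMeasurable fun p => hC _
  calc ∫ U, Φ U ∂(zdHaar d G)
      = ∫ U, Φ U ∂(((zdHaar d G).prod (Measure.pi fun _ : ↥Δ => haarProbability G)).map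
          fun p => glueWith Δ p.2 p.1) := by rw [hmap]
    _ = ∫ p, Φ (glueWith Δ p.2 p.1)
          ∂((zdHaar d G).prod (Measure.pi fun _ : ↥Δ => haarProbability G)) :=
        integral_map hg.aemeasurable hΦm.aestronglyMeasurable
    _ = _ := integral_prod _ hint

end Resampling

/-! ### The free-boundary measures satisfy the DLR equations deep inside the region -/

section FreeDLR

variable {d N : ℕ} {G : Type*} [Group G] [TopologicalSpace G] [IsTopologicalGroup G]
  [CompactSpace G] [MeasurableSpace G] [BorelSpace G] [SecondCountableTopology G]
  (ρ : G →* Matrix (Fin N) (Fin N) ℂ)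

/-- **The free-boundary Wilson measure satisfies the DLR equation of `ymSpecification`** for every
finite edge set `Δ` all of whose plaquettes (the plaquettes with an edge in `Δ`) have their four
corners in the region `Λ`: `μ_{Λ,β}(F) = μ_{Λ,β}(γ_Δ F)` for bounded continuous `F`. The action
splits as `S_Λ = S_Δ + R` with `R` insensitive to the links in `Δ`, and under `dg_∞` the links in
`Δ` may be resampled independently (Georgii 2011, Prop. 2.5 / (1.21); Friedli–Velenik 2017,
Lemma 6.7 and Exercise 6.14 on free boundary conditions). [cite: Georgii2011, Prop. 2.5] -/
theorem integral_zdWilsonMeasure_eq_integral_integral_ymSpecification (hρ : Continuous ρ) (β : ℝ)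
    {Λ : Finset (Literature.Probability.LatticeModels.Site d)} {Δ : Finset (ZdEdge d)}
    (hΔ : ∀ p ∈ plaquettesTouching Δ, ((p.1, p.2.1.1, p.2.1.2) : Plaq d) ∈ plaquettesIn Λ)
    {F : ZdGaugeConfig d G → ℝ} (hFc : Continuous F) :
    ∫ U, F U ∂(zdWilsonMeasure ρ β Λ) =
      ∫ η, (∫ U, F U ∂(ymSpecification ρ β Δ η)) ∂(zdWilsonMeasure ρ β Λ) := by
  classical
  obtain ⟨C, hC⟩ := QuantumLattice.exists_bound_of_continuous hFc
  set π : Measure (↥Δ → G) := Measure.pi fun _ : ↥Δ => haarProbability G with hπ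
  set γF : ZdGaugeConfig d G → ℝ := fun η => ∫ U, F U ∂(ymSpecification ρ β Δ η) with hγF
  have hγFc : Continuous γF :=
    QuantumLattice.continuous_integral_ymSpecification ρ hρ β Δ hFc hC
  -- the plaquettes touching `Δ`, as labels of `plaquettesIn Λ`
  set ι : ZdPlaquette d → Plaq d := fun p => (p.1, p.2.1.1, p.2.1.2) with hι
  have hιinj : Function.Injective ι := by
    rintro ⟨x, ⟨⟨i, j⟩, hij⟩⟩ ⟨x', ⟨⟨i', j'⟩, hij'⟩⟩ h
    simp only [hι, Prod.mk.injEq] at h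
    obtain ⟨rfl, rfl, rfl⟩ := h
    rfl
  set P : Finset (Plaq d) := (plaquettesTouching Δ).image ι with hP
  have hPsub : P ⊆ plaquettesIn Λ := Finset.image_subset_iff.2 hΔ
  -- near and far parts of the action
  set a : ZdGaugeConfig d G → ℝ := fun U => -β * wilsonBoundaryAction ρ Δ U with ha
  set b : ZdGaugeConfig d G → ℝ := fun U => -β * ∑ q ∈ plaquettesIn Λ \ P, plaqCost ρ q U
    with hb
  have hab : ∀ U, -β * zdWilsonAction ρ Λ U = a U + b U := by
    intro U
    have hsum : ∑ q ∈ P, plaqCost ρ q U = wilsonBoundaryAction ρ Δ U := by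
      rw [hP, Finset.sum_image fun p _ q _ h => hιinj h]
      rfl
    rw [zdWilsonAction_eq_sum, ← Finset.sum_sdiff hPsub, hsum, ha, hb]
    ring
  -- `b` does not feel the links in `Δ`
  have hbglue : ∀ (ζ : ↥Δ → G) (η : ZdGaugeConfig d G), b (glueWith Δ ζ η) = b η := by
    intro ζ η
    simp only [hb]
    congr 1
    refine Finset.sum_congr rfl fun q hq => ?_
    rw [Finset.mem_sdiff] at hq
    refine dependsOn_plaqCost q fun e he => glueWith_apply_not_mem _ _ _ fun heΔ => hq.2 ?_
    have hlt : q.2.1 < q.2.2 := (Plaq.mem_plaquettesIn.1 hq.1).2.1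
    refine Finset.mem_image.2 ⟨(q.1, ⟨(q.2.1, q.2.2), hlt⟩), ?_, rfl⟩
    refine mem_plaquettesTouching_iff.2 ⟨e, Finset.mem_inter.2 ⟨?_, heΔ⟩⟩
    simpa [plaquetteEdges, Plaq.bonds] using he
  -- the kernel does not feel the links in `Δ` of the boundary condition
  have hγglue : ∀ (ζ : ↥Δ → G) (η : ZdGaugeConfig d G), γF (glueWith Δ ζ η) = γF η := by
    intro ζ η
    have hgg : (fun ζ' : ↥Δ → G => glueWith Δ ζ' (glueWith Δ ζ η)) =
        fun ζ' => glueWith Δ ζ' η := by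
      funext ζ' e
      by_cases he : e ∈ Δ
      · simp [glueWith_apply_mem _ _ _ he]
      · simp [glueWith_apply_not_mem _ _ _ he]
    simp only [hγF, ymSpecification, hgg]
  -- continuity, bounds
  have hSc : Continuous (zdWilsonAction ρ Λ) := AreaLaw.continuous_zdWilsonAction ρ hρ Λ
  have hac : Continuous a :=
    continuous_const.mul (QuantumLattice.continuous_wilsonBoundaryAction ρ hρ Δ)
  have hbc : Continuous b := by
    have : b = fun U => -β * zdWilsonAction ρ Λ U - a U := funext fun U => by rw [hab]; ring
    rw [this]
    exact (continuous_const.mul hSc).sub hac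
  obtain ⟨A, hA⟩ := QuantumLattice.exists_bound_of_continuous hac
  obtain ⟨B, hB⟩ := QuantumLattice.exists_bound_of_continuous hbc
  have hγFb : ∀ η, |γF η| ≤ C := QuantumLattice.abs_integral_ymSpecification_le ρ hρ β Δ hC
  -- the fibre integrals
  set N1 : ZdGaugeConfig d G → ℝ := fun η => ∫ ζ, Real.exp (a (glueWith Δ ζ η)) ∂π with hN1
  have hγF_eq : ∀ η, γF η * N1 η =
      ∫ ζ, F (glueWith Δ ζ η) * Real.exp (a (glueWith Δ ζ η)) ∂π := by
    intro η
    have hpos : 0 < N1 η := by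
      simp only [hN1, ha]; exact QuantumLattice.normaliser_pos ρ hρ β Δ η
    have := QuantumLattice.integral_ymSpecification ρ hρ β Δ hFc.measurable η
    simp only [hγF, hN1, ha] at this ⊢
    rw [this, div_mul_cancel₀ _ hpos.ne']
  -- both sides as ratios of `dg_∞`-integrals
  rw [show (∫ U, F U ∂zdWilsonMeasure ρ β Λ) = zdExpect ρ β Λ F from rfl,
    show (∫ η, γF η ∂zdWilsonMeasure ρ β Λ) = zdExpect ρ β Λ γF from rfl,
    AreaLaw.zdExpect_eq_div_integral ρ hρ β Λ F, AreaLaw.zdExpect_eq_div_integral ρ hρ β Λ γF]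
  congr 1
  have e1 : (fun U => F U * Real.exp (-β * zdWilsonAction ρ Λ U)) =
      fun U => Real.exp (b U) * (F U * Real.exp (a U)) := by
    funext U; rw [hab, Real.exp_add]; ring
  have e2 : (fun U => γF U * Real.exp (-β * zdWilsonAction ρ Λ U)) =
      fun U => Real.exp (b U) * (γF U * Real.exp (a U)) := by
    funext U; rw [hab, Real.exp_add]; ring
  have hexpa : ∀ U, |Real.exp (a U)| ≤ Real.exp A := fun U => by
    rw [abs_of_pos (Real.exp_pos _), Real.exp_le_exp]; exact (le_abs_self _).trans (hA U)
  have hexpb : ∀ U, |Real.exp (b U)| ≤ Real.exp B := fun U => by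
    rw [abs_of_pos (Real.exp_pos _), Real.exp_le_exp]; exact (le_abs_self _).trans (hB U)
  have hm1 : Measurable fun U => Real.exp (b U) * (F U * Real.exp (a U)) :=
    (Real.measurable_exp.comp hbc.measurable).mul
      (hFc.measurable.mul (Real.measurable_exp.comp hac.measurable))
  have hm2 : Measurable fun U => Real.exp (b U) * (γF U * Real.exp (a U)) :=
    (Real.measurable_exp.comp hbc.measurable).mul
      (hγFc.measurable.mul (Real.measurable_exp.comp hac.measurable))
  have hb1 : ∀ U, |Real.exp (b U) * (F U * Real.exp (a U))| ≤ Real.exp B * (C * Real.exp A) :=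
    fun U => by
      rw [abs_mul, abs_mul]
      exact mul_le_mul (hexpb U) (mul_le_mul (hC U) (hexpa U) (abs_nonneg _)
        ((abs_nonneg _).trans (hC U))) (by positivity) (Real.exp_pos _).le
  have hb2 : ∀ U, |Real.exp (b U) * (γF U * Real.exp (a U))| ≤ Real.exp B * (C * Real.exp A) :=
    fun U => by
      rw [abs_mul, abs_mul]
      exact mul_le_mul (hexpb U) (mul_le_mul (hγFb U) (hexpa U) (abs_nonneg _)
        ((abs_nonneg _).trans (hC (glueWith Δ 1 U)))) (by positivity) (Real.exp_pos _).le
  rw [e1, e2, integral_zdHaar_eq_integral_integral_glueWith Δ hm1 hb1,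
    integral_zdHaar_eq_integral_integral_glueWith Δ hm2 hb2]
  refine integral_congr_ae (ae_of_all _ fun η => ?_)
  simp only [hbglue, hγglue]
  rw [integral_const_mul, integral_const_mul]
  congr 1
  rw [← hγF_eq η, hN1, ← integral_const_mul]

/-- A finite set of lattice sites lies in all large centred boxes. [folklore] -/
theorem finset_eventually_subset_box (K : Finset (Literature.Probability.LatticeModels.Site d)) : ∀ᶠ L : ℕ in atTop, K ⊆ box d L :=
  Filter.tendsto_atTop.1 (tendsto_box_atTop d) K

/-- The plaquettes touching a finite edge set lie in all large centred boxes. [folklore] -/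
theorem eventually_plaquettesTouching_mem_plaquettesIn_box (Δ : Finset (ZdEdge d)) :
    ∀ᶠ L : ℕ in atTop, ∀ p ∈ plaquettesTouching Δ,
      ((p.1, p.2.1.1, p.2.1.2) : Plaq d) ∈ plaquettesIn (box d L) := by
  classical
  set K : Finset (Literature.Probability.LatticeModels.Site d) := (plaquettesTouching Δ).biUnion fun p =>
    {p.1, p.1 + Pi.single p.2.1.1 1, p.1 + Pi.single p.2.1.2 1,
      p.1 + Pi.single p.2.1.1 1 + Pi.single p.2.1.2 1} with hK
  filter_upwards [finset_eventually_subset_box K] with L hL p hp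
  have hsub : ({p.1, p.1 + Pi.single p.2.1.1 1, p.1 + Pi.single p.2.1.2 1,
      p.1 + Pi.single p.2.1.1 1 + Pi.single p.2.1.2 1} : Finset (Literature.Probability.LatticeModels.Site d)) ⊆ box d L :=
    (Finset.subset_biUnion_of_mem _ hp).trans hL
  rw [Plaq.mem_plaquettesIn]
  refine ⟨hsub (by simp), p.2.2, hsub (by simp), hsub (by simp), hsub (by simp)⟩

variable [T2Space G]

/-- **Free-boundary infinite-volume limits are lattice Yang–Mills DLR states.** Every weak
subsequential limit of the free-boundary Wilson measures on the centred cubes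
(`Sweep1.IsInfiniteVolumeLimit`) satisfies the DLR equations of `ymSpecification ρ β`
(Georgii 2011, Thm. 4.17; Friedli–Velenik 2017, Thm. 6.26 with Exercise 6.14: free boundary
conditions; Seiler LNP 159 Ch. 2). For bounded continuous `F` the cubes eventually contain all
plaquettes touching `Δ`, so `μ_{Λ_L}(F) = μ_{Λ_L}(γ_Δ F)`
(`integral_zdWilsonMeasure_eq_integral_integral_ymSpecification`); `γ_Δ F` is bounded continuous
(Feller), so the identity passes to the limit, and bounded continuous functions determine finite
Borel measures on the compact metrisable configuration space. [cite: Georgii2011, Thm. 4.17] -/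
theorem mem_ymGibbsMeasures_of_isInfiniteVolumeLimit (hρ : Continuous ρ) {β : ℝ}
    {μ : Measure (ZdGaugeConfig d G)} (hμ : IsInfiniteVolumeLimit ρ β μ) :
    μ ∈ ymGibbsMeasures ρ β := by
  classical
  obtain ⟨hprob, φ, hφ, hlim⟩ := hμ
  refine ⟨hprob, fun Δ A hA => ?_⟩
  -- Step 1: `μ(F) = μ(γ_Δ F)` for bounded continuous `F`
  have core : ∀ F : ZdGaugeConfig d G → ℝ, Continuous F → ∀ C : ℝ, (∀ U, |F U| ≤ C) →
      ∫ U, F U ∂μ = ∫ η, (∫ U, F U ∂(ymSpecification ρ β Δ η)) ∂μ := by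
    intro F hFc C hC
    have hbdd : ∀ {g : ZdGaugeConfig d G → ℝ} {C : ℝ}, (∀ U, |g U| ≤ C) →
        Bornology.IsBounded (Set.range g) := fun {g C} hg =>
      isBounded_iff_forall_norm_le.2 ⟨C, by rintro _ ⟨U, rfl⟩; simpa [Real.norm_eq_abs] using hg U⟩
    have h1 := hlim F hFc (hbdd hC)
    have hγc := QuantumLattice.continuous_integral_ymSpecification ρ hρ β Δ hFc hC
    have hγb := QuantumLattice.abs_integral_ymSpecification_le ρ hρ β Δ hC
    have h2 := hlim (fun η => ∫ U, F U ∂(ymSpecification ρ β Δ η)) hγc (hbdd hγb)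
    have hev : ∀ᶠ k in atTop, zdExpect ρ β (box d (φ k)) F =
        zdExpect ρ β (box d (φ k)) fun η => ∫ U, F U ∂(ymSpecification ρ β Δ η) :=
      (hφ.tendsto_atTop.eventually (eventually_plaquettesTouching_mem_plaquettesIn_box Δ)).mono
        fun k hk => integral_zdWilsonMeasure_eq_integral_integral_ymSpecification ρ hρ β hk hFc
    exact tendsto_nhds_unique (h1.congr' hev) h2
  -- Step 2: `μ = μ γ_Δ` as measures, tested on bounded continuous functions
  have hκ : Measurable (ymSpecification ρ β Δ) :=
    Measure.measurable_of_measurable_coe _ fun s hs =>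
      QuantumLattice.measurable_ymSpecification_apply ρ hρ β Δ hs
  have hμeq : μ = μ.bind (ymSpecification ρ β Δ) := by
    refine ext_of_forall_lintegral_eq_of_IsFiniteMeasure fun f => ?_
    have hfm : Measurable fun x => (f x : ENNReal) :=
      measurable_coe_nnreal_ennreal.comp f.continuous.measurable
    rw [Measure.lintegral_bind hκ.aemeasurable hfm.aemeasurable]
    have hfc : Continuous fun x => (f x : ℝ) := NNReal.continuous_coe.comp f.continuous
    have hfb : ∀ x, |(f x : ℝ)| ≤ nndist f 0 := fun x => by
      rw [abs_of_nonneg (f x).coe_nonneg]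
      exact_mod_cast BoundedContinuousFunction.NNReal.upper_bound f x
    have hint : ∀ (m : Measure (ZdGaugeConfig d G)) [IsFiniteMeasure m],
        ∫⁻ x, (f x : ENNReal) ∂m = ENNReal.ofReal (∫ x, (f x : ℝ) ∂m) := by
      intro m _
      rw [← BoundedContinuousFunction.toReal_lintegral_coe_eq_integral,
        ENNReal.ofReal_toReal (BoundedContinuousFunction.lintegral_lt_top_of_nnreal m f).ne]
    have hpt : (fun η => ∫⁻ x, (f x : ENNReal) ∂(ymSpecification ρ β Δ η)) = fun η =>
        ENNReal.ofReal (∫ x, (f x : ℝ) ∂(ymSpecification ρ β Δ η)) :=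
      funext fun η => by
        haveI := QuantumLattice.isProbabilityMeasure_ymSpecification ρ hρ β Δ η
        exact hint _
    rw [hint μ, hpt, ← ofReal_integral_eq_lintegral_ofReal]
    · rw [core _ hfc _ hfb]
    · exact QuantumLattice.integrable_of_bound
        (QuantumLattice.continuous_integral_ymSpecification ρ hρ β Δ hfc hfb).aestronglyMeasurable
        (QuantumLattice.abs_integral_ymSpecification_le ρ hρ β Δ hfb)
    · exact ae_of_all _ fun η => integral_nonneg fun x => (f x).coe_nonneg
  -- Step 3: the DLR equation for `A`
  calc ∫⁻ η, ymSpecification ρ β Δ η A ∂μ = (μ.bind (ymSpecification ρ β Δ)) A :=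
        (Measure.bind_apply hA hκ.aemeasurable).symm
    _ = μ A := by rw [← hμeq]

end FreeDLR

/-! ### Uniqueness of the DLR state: convergence of the torus states, translation invariance -/

section TorusLimit

variable {d N : ℕ} {G : Type*} [Group G] [TopologicalSpace G] [IsTopologicalGroup G]
  [CompactSpace G] [MeasurableSpace G] [BorelSpace G] (ρ : G →* Matrix (Fin N) (Fin N) ℂ)

/-- The torus states on `ℤ^d` are translation invariant (the torus Wilson state is invariant under
torus translations, `wilsonMeasure_map_torusConfigShift`, and the periodic lift intertwines the
translations). [folklore] -/
theorem torusState_map_configShift (β : ℝ) (L : ℕ) [NeZero L] (v : Literature.Probability.LatticeModels.Site d) :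
    (torusState (d := d) ρ β L).map (configShift v) = torusState ρ β L := by
  have hcomm : (configShift (G := G) v : LGConfig d G → LGConfig d G) ∘ torusLift L =
      torusLift L ∘ torusConfigShift (Literature.Probability.LatticeModels.Torus.proj L v) := by
    funext U e
    simp only [Function.comp_apply, configShift_apply, torusLift, torusEdge,
      torusConfigShift_apply]
    congr 2
    funext i
    simp [Literature.Probability.LatticeModels.Torus.proj_apply]
  rw [torusState, Measure.map_map (configShift v).measurable (measurable_torusLift L), hcomm,
    ← Measure.map_map (measurable_torusLift L) (torusConfigShift _).measurable,
    wilsonMeasure_map_torusConfigShift]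

variable [T2Space G] [SecondCountableTopology G]

/-- **Uniqueness of the DLR state forces convergence of the torus states.** If
`𝒢(ymSpecification ρ β)` has at most one element `μ`, then the full sequence of torus Wilson
states `μ_{Λ_{L+1},β}` (on `ℤ^d`) converges to `μ` on every bounded continuous function: the
space of probability measures on the compact metrisable `G^{edges(ℤ^d)}` is compact and
metrisable, every subsequential limit is an infinite-volume limit point, hence a DLR state
(`mem_ymGibbsMeasures_of_mem_infiniteVolumeLimitPoints_holds`), hence `μ`
(Friedli–Velenik 2017, Lemma 6.30 with Thm. 6.26; Georgii 2011, Thm. 4.17). [cite: FriedliVelenik2017, Lemma 6.30] -/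
theorem tendsto_integral_torusState_of_subsingleton (hρ : Continuous ρ) {β : ℝ}
    (hsub : (ymGibbsMeasures (d := d) ρ β).Subsingleton)
    {μ : Measure (LGConfig d G)} (hμ : μ ∈ ymGibbsMeasures ρ β)
    {f : LGConfig d G → ℝ} (hf : Continuous f) {C : ℝ} (hC : ∀ U, |f U| ≤ C) :
    Tendsto (fun L : ℕ => ∫ U, f U ∂(torusState ρ β (L + 1))) atTop (𝓝 (∫ U, f U ∂μ)) := by
  haveI := fun L : ℕ => isProbabilityMeasure_torusState (d := d) (L := L + 1) ρ hρ β
  haveI : IsProbabilityMeasure μ := hμ.1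
  let P : ℕ → ProbabilityMeasure (LGConfig d G) := fun L => ⟨torusState ρ β (L + 1), inferInstance⟩
  let Pμ : ProbabilityMeasure (LGConfig d G) := ⟨μ, inferInstance⟩
  have key : Tendsto P atTop (𝓝 Pμ) := by
    refine tendsto_of_subseq_tendsto fun ns hns => ?_
    obtain ⟨φ₁, -, hmono⟩ := strictMono_subseq_of_tendsto_atTop hns
    obtain ⟨ν, -, φ₂, hφ₂, hν⟩ :=
      (isCompact_univ (X := ProbabilityMeasure (LGConfig d G))).tendsto_subseq
        fun n => Set.mem_univ (P (ns (φ₁ n)))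
    refine ⟨φ₁ ∘ φ₂, ?_⟩
    have hνlim : (ν : Measure (LGConfig d G)) ∈ infiniteVolumeLimitPoints ρ β := by
      refine ⟨ns ∘ φ₁ ∘ φ₂, hmono.comp hφ₂, inferInstance, fun F S _ hFc hFb => ?_⟩
      obtain ⟨C', hC'⟩ := hFb
      let Fb : LGConfig d G →ᵇ ℝ := BoundedContinuousFunction.ofNormedAddCommGroup F hFc C'
        (fun U => by simpa [Real.norm_eq_abs] using hC' U)
      have h := (ProbabilityMeasure.tendsto_iff_forall_integral_tendsto.1 hν) Fb
      have hE : (fun k : ℕ => wilsonExpectation (L := (ns ∘ φ₁ ∘ φ₂) k + 1) ρ β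
          (toTorusObservable ((ns ∘ φ₁ ∘ φ₂) k + 1) F)) =
          fun k => ∫ U, Fb U ∂(P (ns (φ₁ (φ₂ k))) : Measure (LGConfig d G)) :=
        funext fun k => wilsonExpectation_toTorusObservable ρ β _ hFc.measurable
      rw [hE]
      exact h
    have hνG := QuantumLattice.mem_ymGibbsMeasures_of_mem_infiniteVolumeLimitPoints_holds ρ hρ hνlim
    have hνμ : ν = Pμ := Subtype.ext (hsub hνG hμ)
    rw [← hνμ]
    exact hν
  let fb : LGConfig d G →ᵇ ℝ := BoundedContinuousFunction.ofNormedAddCommGroup f hf C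
    (fun U => by simpa [Real.norm_eq_abs] using hC U)
  exact (ProbabilityMeasure.tendsto_iff_forall_integral_tendsto.1 key) fb

/-- **Translation invariance of the limit of the torus states**: if the torus states converge to
the probability measure `μ` on bounded continuous functions, then `μ ∘ θ_v⁻¹ = μ` for every
lattice vector `v` (the torus states are translation invariant and bounded continuous functions
separate finite Borel measures). [folklore] -/
theorem map_configShift_eq_of_tendsto_torusState {β : ℝ} {μ : Measure (LGConfig d G)}
    [IsProbabilityMeasure μ]
    (hlim : ∀ f : LGConfig d G → ℝ, Continuous f → ∀ C : ℝ, (∀ U, |f U| ≤ C) →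
      Tendsto (fun L : ℕ => ∫ U, f U ∂(torusState ρ β (L + 1))) atTop (𝓝 (∫ U, f U ∂μ)))
    (v : Literature.Probability.LatticeModels.Site d) : μ.map (configShift v) = μ := by
  haveI : IsProbabilityMeasure (μ.map (configShift v)) :=
    Measure.isProbabilityMeasure_map (configShift v).measurable.aemeasurable
  refine ext_of_forall_integral_eq_of_IsFiniteMeasure fun f => ?_
  rw [integral_map (configShift v).measurable.aemeasurable f.continuous.aestronglyMeasurable]
  have hfc : Continuous fun U => f (configShift v U) :=
    f.continuous.comp (continuous_configShift v)
  have hb : ∀ U, |f U| ≤ ‖f‖ := fun U => by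
    simpa [Real.norm_eq_abs] using f.norm_coe_le_norm U
  have h1 := hlim (fun U => f (configShift v U)) hfc ‖f‖ fun U => hb _
  have h2 := hlim f f.continuous ‖f‖ hb
  have heq : ∀ L : ℕ, ∫ U, f (configShift v U) ∂(torusState ρ β (L + 1)) =
      ∫ U, f U ∂(torusState ρ β (L + 1)) := fun L => by
    rw [← integral_map (configShift v).measurable.aemeasurable f.continuous.aestronglyMeasurable,
      torusState_map_configShift]
  simp_rw [heq] at h1
  exact tendsto_nhds_unique h1 h2

end TorusLimit

/-! ### The concrete model `SU(N)`: plaquette observables are Lipschitz cylinder functions -/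

section Quartic

variable {N : ℕ}

/-- Telescoping bound for products of four numbers of modulus `≤ 1`. [folklore] -/
theorem norm_mul₄_sub_mul₄_le {a b c e a' b' c' e' : ℂ} (hb : ‖b‖ ≤ 1) (hc : ‖c‖ ≤ 1)
    (he : ‖e‖ ≤ 1) (ha' : ‖a'‖ ≤ 1) (hb' : ‖b'‖ ≤ 1) (hc' : ‖c'‖ ≤ 1) :
    ‖a * b * c * e - a' * b' * c' * e'‖ ≤ ‖a - a'‖ + ‖b - b'‖ + ‖c - c'‖ + ‖e - e'‖ := by
  have h : a * b * c * e - a' * b' * c' * e' =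
      (a - a') * b * c * e + a' * (b - b') * c * e + a' * b' * (c - c') * e +
        a' * b' * c' * (e - e') := by ring
  rw [h]
  have h1 : ‖(a - a') * b * c * e‖ ≤ ‖a - a'‖ := by
    rw [norm_mul, norm_mul, norm_mul]
    calc ‖a - a'‖ * ‖b‖ * ‖c‖ * ‖e‖ ≤ ‖a - a'‖ * 1 * 1 * 1 := by gcongr
      _ = ‖a - a'‖ := by ring
  have h2 : ‖a' * (b - b') * c * e‖ ≤ ‖b - b'‖ := by
    rw [norm_mul, norm_mul, norm_mul]
    calc ‖a'‖ * ‖b - b'‖ * ‖c‖ * ‖e‖ ≤ 1 * ‖b - b'‖ * 1 * 1 := by gcongr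
      _ = ‖b - b'‖ := by ring
  have h3 : ‖a' * b' * (c - c') * e‖ ≤ ‖c - c'‖ := by
    rw [norm_mul, norm_mul, norm_mul]
    calc ‖a'‖ * ‖b'‖ * ‖c - c'‖ * ‖e‖ ≤ 1 * 1 * ‖c - c'‖ * 1 := by gcongr
      _ = ‖c - c'‖ := by ring
  have h4 : ‖a' * b' * c' * (e - e')‖ ≤ ‖e - e'‖ := by
    rw [norm_mul, norm_mul, norm_mul]
    calc ‖a'‖ * ‖b'‖ * ‖c'‖ * ‖e - e'‖ ≤ 1 * 1 * 1 * ‖e - e'‖ := by gcongr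
      _ = ‖e - e'‖ := by ring
  exact (norm_add_le _ _).trans (add_le_add ((norm_add_le _ _).trans (add_le_add
    ((norm_add_le _ _).trans (add_le_add h1 h2)) h3)) h4)

/-- The plaquette polynomial `m ↦ N⁻¹ Re tr(m₁ m₂ m₃ᴴ m₄ᴴ)` of four matrices of entries, written
as an explicit quadruple sum, is `4N³`-Lipschitz (sup metric) on the unit ball. [folklore] -/
theorem lipschitzOnWith_plaquettePoly {E : Type*} [Fintype E] (k₁ k₂ k₃ k₄ : E) :
    LipschitzOnWith (4 * (N : ℝ≥0) ^ 3)
      (fun m : E → Fin N → Fin N → ℂ => (N : ℝ)⁻¹ *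
        (∑ a : Fin N, ∑ e : Fin N, ∑ c : Fin N, ∑ b : Fin N,
          m k₁ a b * m k₂ b c * (starRingEnd ℂ) (m k₃ e c) * (starRingEnd ℂ) (m k₄ a e)).re)
      (Metric.closedBall 0 1) := by
  refine LipschitzOnWith.of_dist_le_mul fun m hm m' hm' => ?_
  rw [Metric.mem_closedBall, dist_zero_right] at hm hm'
  have hent : ∀ {m : E → Fin N → Fin N → ℂ}, ‖m‖ ≤ 1 → ∀ k a b, ‖m k a b‖ ≤ 1 :=
    fun {m} hm k a b =>
      ((norm_le_pi_norm (m k a) b).trans ((norm_le_pi_norm (m k) a).trans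
        (norm_le_pi_norm m k))).trans hm
  have hdiff : ∀ k a b, ‖m k a b - m' k a b‖ ≤ ‖m - m'‖ := fun k a b =>
    calc ‖m k a b - m' k a b‖ = ‖(m - m') k a b‖ := by simp
      _ ≤ ‖m - m'‖ := (norm_le_pi_norm _ b).trans ((norm_le_pi_norm _ a).trans
          (norm_le_pi_norm _ k))
  set T : (E → Fin N → Fin N → ℂ) → Fin N → Fin N → Fin N → Fin N → ℂ := fun m a e c b =>
    m k₁ a b * m k₂ b c * (starRingEnd ℂ) (m k₃ e c) * (starRingEnd ℂ) (m k₄ a e) with hT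
  have hTle : ∀ a e c b, ‖T m a e c b - T m' a e c b‖ ≤ 4 * ‖m - m'‖ := by
    intro a e c b
    simp only [hT]
    refine (norm_mul₄_sub_mul₄_le (hent hm k₂ b c) (by rw [RCLike.norm_conj]; exact hent hm k₃ e c)
      (by rw [RCLike.norm_conj]; exact hent hm k₄ a e) (hent hm' k₁ a b) (hent hm' k₂ b c)
      (by rw [RCLike.norm_conj]; exact hent hm' k₃ e c)).trans ?_
    rw [← map_sub, ← map_sub, RCLike.norm_conj, RCLike.norm_conj]
    linarith [hdiff k₁ a b, hdiff k₂ b c, hdiff k₃ e c, hdiff k₄ a e]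
  have hS : ‖(∑ a, ∑ e, ∑ c, ∑ b, T m a e c b) - ∑ a, ∑ e, ∑ c, ∑ b, T m' a e c b‖ ≤
      (N : ℝ) ^ 4 * (4 * ‖m - m'‖) := by
    simp only [← Finset.sum_sub_distrib]
    refine (norm_sum_le _ _).trans ((Finset.sum_le_sum fun a _ => (norm_sum_le _ _).trans
      (Finset.sum_le_sum fun e _ => (norm_sum_le _ _).trans (Finset.sum_le_sum fun c _ =>
        (norm_sum_le _ _).trans (Finset.sum_le_sum fun b _ => hTle a e c b)))).trans ?_)
    simp only [Finset.sum_const, Finset.card_univ, Fintype.card_fin]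
    ring_nf
    rfl
  change dist ((N : ℝ)⁻¹ * (∑ a, ∑ e, ∑ c, ∑ b, T m a e c b).re)
    ((N : ℝ)⁻¹ * (∑ a, ∑ e, ∑ c, ∑ b, T m' a e c b).re) ≤ _
  rw [Real.dist_eq, dist_eq_norm, ← mul_sub, abs_mul, abs_inv, Nat.abs_cast, ← Complex.sub_re]
  have hre := (Complex.abs_re_le_norm
    ((∑ a, ∑ e, ∑ c, ∑ b, T m a e c b) - ∑ a, ∑ e, ∑ c, ∑ b, T m' a e c b)).trans hS
  rcases Nat.eq_zero_or_pos N with hN | hN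
  · subst hN
    simp
  · have hN' : (0 : ℝ) < N := by exact_mod_cast hN
    calc (N : ℝ)⁻¹ * |((∑ a, ∑ e, ∑ c, ∑ b, T m a e c b) -
          ∑ a, ∑ e, ∑ c, ∑ b, T m' a e c b).re|
        ≤ (N : ℝ)⁻¹ * ((N : ℝ) ^ 4 * (4 * ‖m - m'‖)) :=
          mul_le_mul_of_nonneg_left hre (inv_nonneg.2 hN'.le)
      _ = ((4 * (N : ℝ≥0) ^ 3 : ℝ≥0) : ℝ) * ‖m - m'‖ := by
          rw [inv_mul_eq_div, div_eq_iff hN'.ne']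
          push_cast
          ring

end Quartic

section Concrete

variable {d N : ℕ}

/-- **Plaquette observables of `SU(N)` are Lipschitz cylinder functions** with support the four
links of the plaquette and constant `4N³` (the plaquette polynomial is `4N³`-Lipschitz on the unit
ball of the entry space, which contains the entries of unitary matrices, and extends to a
globally Lipschitz function by McShane's lemma). [folklore] -/
theorem isLipschitzCylinder_zdPlaquetteObs (x : Literature.Probability.LatticeModels.Site d)
    {i j : Fin d} (hij : i < j) :
    IsLipschitzCylinder (fundamentalRep (Fin N))
      (zdPlaquetteObs (d := d) (fundamentalRep (Fin N)) x i j)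
      (plaquetteEdges ((x, ⟨(i, j), hij⟩) : ZdPlaquette d)) (4 * (N : ℝ≥0) ^ 3) := by
  classical
  set Λ : Finset (QuantumLattice.ZdEdge d) := plaquetteEdges ((x, ⟨(i, j), hij⟩) : ZdPlaquette d)
    with hΛ
  have h₁ : (x, i) ∈ Λ := by simp [hΛ, plaquetteEdges]
  have h₂ : (x + Pi.single i 1, j) ∈ Λ := by simp [hΛ, plaquetteEdges]
  have h₃ : (x + Pi.single j 1, i) ∈ Λ := by simp [hΛ, plaquetteEdges]
  have h₄ : (x, j) ∈ Λ := by simp [hΛ, plaquetteEdges]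
  set g : (↥Λ → Fin N → Fin N → ℂ) → ℝ := fun m => (N : ℝ)⁻¹ *
    (∑ a : Fin N, ∑ e : Fin N, ∑ c : Fin N, ∑ b : Fin N,
      m ⟨_, h₁⟩ a b * m ⟨_, h₂⟩ b c * (starRingEnd ℂ) (m ⟨_, h₃⟩ e c) *
        (starRingEnd ℂ) (m ⟨_, h₄⟩ a e)).re with hg
  have hgL : LipschitzOnWith (4 * (N : ℝ≥0) ^ 3) g (Metric.closedBall 0 1) :=
    lipschitzOnWith_plaquettePoly _ _ _ _
  obtain ⟨f, hf, hfg⟩ := hgL.extend_real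
  refine ⟨f, hf, fun U => ?_⟩
  set m₀ : ↥Λ → Fin N → Fin N → ℂ := fun e a b => (fundamentalRep (Fin N)) (U e) a b with hm₀
  have hm₀b : m₀ ∈ Metric.closedBall (0 : ↥Λ → Fin N → Fin N → ℂ) 1 := by
    rw [Metric.mem_closedBall, dist_zero_right]
    refine (pi_norm_le_iff_of_nonneg zero_le_one).2 fun e =>
      (pi_norm_le_iff_of_nonneg zero_le_one).2 fun a =>
        (pi_norm_le_iff_of_nonneg zero_le_one).2 fun b => ?_
    exact entry_norm_bound_of_unitary (fundamentalRep_mem_unitaryGroup (U e)) a b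
  rw [← hfg hm₀b]
  simp only [hg, hm₀, zdPlaquetteObs, ZdGaugeConfig.plaquette, ← Matrix.star_eq_inv, map_mul,
    fundamentalRep_apply, Matrix.specialUnitaryGroup.coe_star, Matrix.star_eq_conjTranspose,
    Matrix.trace, Matrix.diag_apply, Matrix.mul_apply, Matrix.conjTranspose_apply,
    Complex.star_def, Finset.sum_mul]

/-- The links of a plaquette are based within sup-distance `1` of its base point. [folklore] -/
theorem norm_fst_sub_le_of_mem_plaquetteEdges {p : ZdPlaquette d} {e : QuantumLattice.ZdEdge d}
    (he : e ∈ plaquetteEdges p) : ‖e.1 - p.1‖ ≤ 1 := by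
  have hsingle : ∀ k : Fin d, ‖(Pi.single k (1 : ℤ) : Literature.Probability.LatticeModels.Site d)‖ ≤ 1 := by
    intro k
    refine (pi_norm_le_iff_of_nonneg zero_le_one).2 fun c => ?_
    rw [Pi.single_apply]
    split_ifs <;> simp
  simp only [plaquetteEdges, Finset.mem_insert, Finset.mem_singleton] at he
  rcases he with rfl | rfl | rfl | rfl
  · simp
  · simpa using hsingle _
  · simpa using hsingle _
  · simp

/-- A lower bound for the edge-set distance from a pairwise bound on base points. [folklore] -/
theorem le_setDistEdges_of_forall {Λ Λ' : Finset (QuantumLattice.ZdEdge d)} (hΛ : Λ.Nonempty)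
    (hΛ' : Λ'.Nonempty) {r : ℝ} (h : ∀ e ∈ Λ, ∀ e' ∈ Λ', r ≤ ‖e.1 - e'.1‖) :
    r ≤ setDistEdges Λ Λ' := by
  unfold setDistEdges
  rw [dif_pos (hΛ.product hΛ')]
  exact (Finset.le_inf'_iff _ _).2 fun pq hpq =>
    h _ (Finset.mem_product.1 hpq).1 _ (Finset.mem_product.1 hpq).2

/-- The Euclidean lattice norm is at most `√d` times the sup norm. [folklore] -/
theorem latticeNorm_le_sqrt_mul_norm (z : Literature.Probability.LatticeModels.Site d) :
    latticeNorm z ≤ Real.sqrt d * ‖z‖ := by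
  unfold latticeNorm
  rw [EuclideanSpace.norm_eq]
  have h : ∑ i : Fin d, ‖(WithLp.toLp 2 fun i => (z i : ℝ)) i‖ ^ 2 ≤ ∑ _i : Fin d, ‖z‖ ^ 2 := by
    refine Finset.sum_le_sum fun i _ => ?_
    have hi : ‖(WithLp.toLp 2 fun i => (z i : ℝ)) i‖ = ‖z i‖ := by
      rw [PiLp.toLp_apply, Real.norm_eq_abs, Int.norm_eq_abs]
    rw [hi]
    exact pow_le_pow_left₀ (norm_nonneg _) (norm_le_pi_norm z i) 2
  calc Real.sqrt (∑ i : Fin d, ‖(WithLp.toLp 2 fun i => (z i : ℝ)) i‖ ^ 2)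
      ≤ Real.sqrt (∑ _i : Fin d, ‖z‖ ^ 2) := Real.sqrt_le_sqrt h
    _ = Real.sqrt d * ‖z‖ := by
        rw [Finset.sum_const, Finset.card_univ, Fintype.card_fin, nsmul_eq_mul,
          Real.sqrt_mul (Nat.cast_nonneg _), Real.sqrt_sq (norm_nonneg _)]

/-- Covariances of observables bounded by `1` are bounded by `4` under a probability measure.
[folklore] -/
theorem abs_covariance_le_four {Ω : Type*} [MeasurableSpace Ω] {μ : Measure Ω}
    [IsProbabilityMeasure μ] {X Y : Ω → ℝ} (hX : ∀ ω, |X ω| ≤ 1) (hY : ∀ ω, |Y ω| ≤ 1) :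
    |cov[X, Y; μ]| ≤ 4 := by
  have hE : ∀ {Z : Ω → ℝ}, (∀ ω, |Z ω| ≤ 1) → |μ[Z]| ≤ 1 := fun {Z} hZ => by
    have h := norm_integral_le_of_norm_le_const (μ := μ) (f := Z) (C := 1)
      (ae_of_all _ fun ω => by simpa [Real.norm_eq_abs] using hZ ω)
    simpa [Real.norm_eq_abs] using h
  unfold covariance
  have h := norm_integral_le_of_norm_le_const (μ := μ)
    (f := fun ω => (X ω - μ[X]) * (Y ω - μ[Y])) (C := 4) (ae_of_all _ fun ω => by
      rw [norm_mul, Real.norm_eq_abs, Real.norm_eq_abs]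
      have h1 : |X ω - μ[X]| ≤ 2 := (abs_sub _ _).trans (by linarith [hX ω, hE hX])
      have h2 : |Y ω - μ[Y]| ≤ 2 := (abs_sub _ _).trans (by linarith [hY ω, hE hY])
      nlinarith [abs_nonneg (X ω - μ[X]), abs_nonneg (Y ω - μ[Y])])
  simpa [Real.norm_eq_abs] using h

/-- `|W_p| ≤ 1` for the plaquette observables of a unitary model. [folklore] -/
theorem abs_zdPlaquetteObs_le {G : Type*} [Group G] {ρ : G →* Matrix (Fin N) (Fin N) ℂ}
    (hρ : ∀ g, ρ g ∈ Matrix.unitaryGroup (Fin N) ℂ)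
    (x : Literature.Probability.LatticeModels.Site d) (i j : Fin d) (U : ZdGaugeConfig d G) :
    |zdPlaquetteObs ρ x i j U| ≤ 1 := by
  unfold zdPlaquetteObs
  rcases Nat.eq_zero_or_pos N with hN | hN
  · subst hN; simp
  have h := abs_re_trace_le_of_mem_unitaryGroup (hρ (U.plaquette x i j))
  rw [abs_mul, abs_inv, Nat.abs_cast]
  calc (N : ℝ)⁻¹ * |(ρ (U.plaquette x i j)).trace.re| ≤ (N : ℝ)⁻¹ * N := by gcongr
    _ = 1 := inv_mul_cancel₀ (by exact_mod_cast hN.ne')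

/-- Elementary bookkeeping of constants for the far (disjoint) case of the covariance bound.
[folklore] -/
theorem decay_bound_aux {V c c₁ D nxy L m A B k : ℝ} (hc : 0 < c)
    (hV : V ≤ c₁ * Real.exp (-c * D) * (k + A * B)) (hk : 0 ≤ k)
    (hA0 : 0 ≤ A) (hA : A ≤ 1) (hB0 : 0 ≤ B) (hB : B ≤ 1)
    (hD : nxy - 2 ≤ D) (hmL : m * L ≤ c * nxy) :
    V ≤ max (max c₁ 0 * Real.exp (2 * c) * (k + 1)) (4 * Real.exp (2 * c)) *
      Real.exp (-m * L) := by
  have hexp : 0 ≤ Real.exp (-c * D) := (Real.exp_pos _).le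
  have hc₁ : 0 ≤ max c₁ 0 := le_max_right _ _
  calc V ≤ c₁ * Real.exp (-c * D) * (k + A * B) := hV
    _ ≤ max c₁ 0 * Real.exp (-c * D) * (k + A * B) :=
        mul_le_mul_of_nonneg_right (mul_le_mul_of_nonneg_right (le_max_left _ _) hexp)
          (add_nonneg hk (mul_nonneg hA0 hB0))
    _ ≤ max c₁ 0 * Real.exp (-c * D) * (k + 1) :=
        mul_le_mul_of_nonneg_left (add_le_add le_rfl (mul_le_one₀ hA hB0 hB))
          (mul_nonneg hc₁ hexp)
    _ ≤ max c₁ 0 * (Real.exp (2 * c) * Real.exp (-m * L)) * (k + 1) := by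
        refine mul_le_mul_of_nonneg_right (mul_le_mul_of_nonneg_left ?_ hc₁) (by linarith)
        rw [← Real.exp_add, Real.exp_le_exp]
        have h' : c * (nxy - 2) ≤ c * D := mul_le_mul_of_nonneg_left hD hc.le
        linarith
    _ = max c₁ 0 * Real.exp (2 * c) * (k + 1) * Real.exp (-m * L) := by ring
    _ ≤ _ := mul_le_mul_of_nonneg_right (le_max_left _ _) (Real.exp_pos _).le

/-- Elementary bookkeeping of constants for the near (overlapping) case of the covariance bound.
[folklore] -/
theorem near_bound_aux {V c nxy L m C₁ : ℝ} (hc : 0 < c) (hV : V ≤ 4) (hn : nxy ≤ 2)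
    (hmL : m * L ≤ c * nxy) :
    V ≤ max C₁ (4 * Real.exp (2 * c)) * Real.exp (-m * L) := by
  calc V ≤ 4 := hV
    _ = 4 * Real.exp (2 * c) * Real.exp (-(2 * c)) := by
        rw [mul_assoc, ← Real.exp_add, add_neg_cancel, Real.exp_zero, mul_one]
    _ ≤ 4 * Real.exp (2 * c) * Real.exp (-m * L) := by
        refine mul_le_mul_of_nonneg_left (Real.exp_le_exp.2 ?_) (by positivity)
        have : c * nxy ≤ c * 2 := mul_le_mul_of_nonneg_left hn hc.le
        linarith
    _ ≤ _ := mul_le_mul_of_nonneg_right (le_max_right _ _) (Real.exp_pos _).le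

/-- **Exponential decay of plaquette–plaquette covariances for `SU(N)`** from conjunct (ii) of
`shen_zhu_zhu` (Shen–Zhu–Zhu, CMP 400 (2023), Cor. 1.6 "mass gap", specialised to plaquette
observables): far plaquettes have disjoint supports and edge-set distance `≥ ‖x - y‖_∞ - 2`,
near ones obey the trivial bound `|Cov| ≤ 4`; the Euclidean distance of the base points costs a
factor `√d` in the rate. [cite: arXiv220412737, Cor. 1.6] -/
theorem abs_cov_zdPlaquetteObs_le_of_decay (hd : 0 < d)
    {μ : Measure (LGConfig d (Matrix.specialUnitaryGroup (Fin N) ℂ))} [IsProbabilityMeasure μ]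
    {c c₁ : ℝ} (hc : 0 < c)
    (hc₁ : ∀ (F₁ F₂ : LGConfig d (Matrix.specialUnitaryGroup (Fin N) ℂ) → ℝ)
      (Λ₁ Λ₂ : Finset (QuantumLattice.ZdEdge d)) (K₁ K₂ : ℝ≥0),
      Λ₁.card ≤ 4 → Λ₂.card ≤ 4 → Disjoint Λ₁ Λ₂ →
      IsLipschitzCylinder (fundamentalRep (Fin N)) F₁ Λ₁ K₁ →
      IsLipschitzCylinder (fundamentalRep (Fin N)) F₂ Λ₂ K₂ →
        |cov[F₁, F₂; μ]| ≤ c₁ * Real.exp (-c * setDistEdges Λ₁ Λ₂) *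
          ((K₁ : ℝ) * K₂ + Real.sqrt (∫ U, F₁ U ^ 2 ∂μ) * Real.sqrt (∫ U, F₂ U ^ 2 ∂μ)))
    (x y : Literature.Probability.LatticeModels.Site d) {i j k l : Fin d} (hij : i < j)
    (hkl : k < l) :
    |cov[zdPlaquetteObs (fundamentalRep (Fin N)) x i j,
        zdPlaquetteObs (fundamentalRep (Fin N)) y k l; μ]| ≤
      max (max c₁ 0 * Real.exp (2 * c) *
          (((4 * (N : ℝ≥0) ^ 3 : ℝ≥0) : ℝ) * ((4 * (N : ℝ≥0) ^ 3 : ℝ≥0) : ℝ) + 1))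
        (4 * Real.exp (2 * c)) * Real.exp (-(c / Real.sqrt d) * latticeNorm (x - y)) := by
  have hρu : ∀ g, fundamentalRep (Fin N) g ∈ Matrix.unitaryGroup (Fin N) ℂ :=
    fundamentalRep_mem_unitaryGroup
  have hd0 : (0 : ℝ) < Real.sqrt d := Real.sqrt_pos.2 (by exact_mod_cast hd)
  have hLm : c / Real.sqrt d * latticeNorm (x - y) ≤ c * ‖x - y‖ := by
    calc c / Real.sqrt d * latticeNorm (x - y) ≤ c / Real.sqrt d * (Real.sqrt d * ‖x - y‖) :=
          mul_le_mul_of_nonneg_left (latticeNorm_le_sqrt_mul_norm _) (div_pos hc hd0).le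
      _ = c * ‖x - y‖ := by field_simp
  have hne_p : (plaquetteEdges ((x, ⟨(i, j), hij⟩) : ZdPlaquette d)).Nonempty :=
    ⟨(x, i), by simp [plaquetteEdges]⟩
  have hne_q : (plaquetteEdges ((y, ⟨(k, l), hkl⟩) : ZdPlaquette d)).Nonempty :=
    ⟨(y, k), by simp [plaquetteEdges]⟩
  by_cases hdisj : Disjoint (plaquetteEdges ((x, ⟨(i, j), hij⟩) : ZdPlaquette d))
      (plaquetteEdges ((y, ⟨(k, l), hkl⟩) : ZdPlaquette d))
  · have hcov := hc₁ _ _ _ _ _ _ (card_plaquetteEdges_le _) (card_plaquetteEdges_le _) hdisj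
      (isLipschitzCylinder_zdPlaquetteObs x hij) (isLipschitzCylinder_zdPlaquetteObs y hkl)
    -- the edge-set distance against the distance of the base points
    have hD : ‖x - y‖ - 2 ≤ setDistEdges (plaquetteEdges ((x, ⟨(i, j), hij⟩) : ZdPlaquette d))
        (plaquetteEdges ((y, ⟨(k, l), hkl⟩) : ZdPlaquette d)) := by
      refine le_setDistEdges_of_forall hne_p hne_q fun e he e' he' => ?_
      have h1 := norm_fst_sub_le_of_mem_plaquetteEdges he
      have h2 := norm_fst_sub_le_of_mem_plaquetteEdges he'
      have heq : x - y = (e.1 - e'.1) - (e.1 - x) + (e'.1 - y) := by abel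
      calc ‖x - y‖ - 2 = ‖(e.1 - e'.1) - (e.1 - x) + (e'.1 - y)‖ - 2 := by rw [← heq]
        _ ≤ ‖e.1 - e'.1‖ + ‖e.1 - x‖ + ‖e'.1 - y‖ - 2 := by
            gcongr
            exact (norm_add_le _ _).trans (add_le_add (norm_sub_le _ _) le_rfl)
        _ ≤ ‖e.1 - e'.1‖ := by simp only at h1 h2; linarith
    -- the `L²` norms are at most `1`
    have hL2 : ∀ (z : Literature.Probability.LatticeModels.Site d) (i' j' : Fin d),
        Real.sqrt (∫ U, zdPlaquetteObs (fundamentalRep (Fin N)) z i' j' U ^ 2 ∂μ) ≤ 1 := by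
      intro z i' j'
      have hb : ∀ U, |zdPlaquetteObs (fundamentalRep (Fin N)) z i' j' U ^ 2| ≤ 1 := fun U => by
        rw [abs_pow]
        exact pow_le_one₀ (abs_nonneg _) (abs_zdPlaquetteObs_le hρu z i' j' U)
      have hint := norm_integral_le_of_norm_le_const (μ := μ)
        (f := fun U => zdPlaquetteObs (fundamentalRep (Fin N)) z i' j' U ^ 2) (C := 1)
        (ae_of_all _ fun U => by simpa only [Real.norm_eq_abs] using hb U)
      have h1 : ∫ U, zdPlaquetteObs (fundamentalRep (Fin N)) z i' j' U ^ 2 ∂μ ≤ 1 :=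
        (le_abs_self _).trans (by simpa [Real.norm_eq_abs] using hint)
      calc Real.sqrt _ ≤ Real.sqrt 1 := Real.sqrt_le_sqrt h1
        _ = 1 := Real.sqrt_one
    exact decay_bound_aux hc hcov (mul_nonneg (NNReal.coe_nonneg _) (NNReal.coe_nonneg _))
      (Real.sqrt_nonneg _) (hL2 _ _ _) (Real.sqrt_nonneg _) (hL2 _ _ _) hD hLm
  · -- overlapping plaquettes are close: the trivial bound
    have hnear : ‖x - y‖ ≤ 2 := by
      obtain ⟨e, hep, heq⟩ := Finset.not_disjoint_iff.1 hdisj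
      have h1 := norm_fst_sub_le_of_mem_plaquetteEdges hep
      have h2 := norm_fst_sub_le_of_mem_plaquetteEdges heq
      simp only at h1 h2
      have : x - y = (e.1 - y) - (e.1 - x) := by abel
      rw [this]
      exact (norm_sub_le _ _).trans (by linarith)
    exact near_bound_aux hc (abs_covariance_le_four (abs_zdPlaquetteObs_le hρu x i j)
      (abs_zdPlaquetteObs_le hρu y k l)) hnear hLm

/-- **Shen–Zhu–Zhu for the concrete group `SU(N) = Matrix.specialUnitaryGroup (Fin N) ℂ`**, from
the DLR fact `shen_zhu_zhu d N` (Shen–Zhu–Zhu, CMP 400 (2023), Thm. 1.2, Rem. 1.3, Cor. 1.6).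
[cite: arXiv220412737, Thm. 1.2, Rem. 1.3, Cor. 1.6] -/
theorem shenZhuZhu_strongCoupling_fundamentalRep (h : shen_zhu_zhu d N) :
    shenZhuZhu_strongCoupling (d := d) (fundamentalRep (Fin N)) := by
  intro hN _ hd β hβ
  classical
  haveI : SecondCountableTopology (Matrix (Fin N) (Fin N) ℂ) :=
    inferInstanceAs (SecondCountableTopology (Fin N → Fin N → ℂ))
  haveI : SecondCountableTopology (Matrix.specialUnitaryGroup (Fin N) ℂ) :=
    Topology.IsEmbedding.subtypeVal.secondCountableTopology
  have hρc : Continuous (fundamentalRep (Fin N)) := continuous_fundamentalRep (Fin N)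
  -- the 't Hooft coupling
  have hN0 : (0 : ℝ) < N := by exact_mod_cast (show 0 < N by omega)
  have hd1 : (0 : ℝ) < (d : ℝ) - 1 := by
    have : (2 : ℝ) ≤ d := by exact_mod_cast hd
    linarith
  have hβ' : |β / N| < 1 / (16 * ((d : ℝ) - 1)) := by
    rw [abs_div, Nat.abs_cast, div_lt_iff₀ hN0]
    calc |β| < N / (16 * ((d : ℝ) - 1)) := hβ
      _ = 1 / (16 * ((d : ℝ) - 1)) * N := by field_simp
  have hNβ : (N : ℝ) * (β / N) = β := mul_div_cancel₀ β hN0.ne'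
  obtain ⟨⟨hsub, hne⟩, hdecay⟩ := h hd hN (β / N) hβ'
  rw [hNβ] at hsub hne hdecay
  obtain ⟨μ, hμ⟩ := hne
  haveI : IsProbabilityMeasure μ := hμ.1
  have hlim : ∀ f : LGConfig d (Matrix.specialUnitaryGroup (Fin N) ℂ) → ℝ, Continuous f →
      ∀ C : ℝ, (∀ U, |f U| ≤ C) →
      Tendsto (fun L : ℕ => ∫ U, f U ∂(torusState (fundamentalRep (Fin N)) β (L + 1))) atTop
        (𝓝 (∫ U, f U ∂μ)) := fun f hf C hC =>
    tendsto_integral_torusState_of_subsingleton (fundamentalRep (Fin N)) hρc hsub hμ hf hC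
  refine ⟨μ, hμ.1, ?_, ?_, ?_, ?_⟩
  · -- convergence of the periodic states along the full sequence
    intro f hf hfb
    obtain ⟨C, hC⟩ := isBounded_iff_forall_norm_le.1 hfb
    have hC' : ∀ U, |f U| ≤ C := fun U => by
      simpa [Real.norm_eq_abs] using hC (f U) (Set.mem_range_self U)
    simpa only [periodicState_eq_torusState] using hlim f hf C hC'
  · -- translation invariance
    intro a
    rw [translate_eq_configShift]
    exact map_configShift_eq_of_tendsto_torusState (fundamentalRep (Fin N)) hlim (-a)
  · -- uniqueness: free-boundary limits are DLR states
    intro μ' hμ'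
    exact hsub (mem_ymGibbsMeasures_of_isInfiniteVolumeLimit (fundamentalRep (Fin N)) hρc hμ') hμ
  · -- exponential decay of plaquette–plaquette covariances
    obtain ⟨c, hc, hn⟩ := hdecay μ hμ
    obtain ⟨c₁, hc₁⟩ := hn 4
    exact ⟨_, c / Real.sqrt d, div_pos hc (Real.sqrt_pos.2 (by exact_mod_cast (show 0 < d by omega))),
      fun x y i j k l hij hkl => abs_cov_zdPlaquetteObs_le_of_decay (by omega) hc hc₁ x y hij hkl⟩

end Concrete

/-! ### Transport along an isomorphism of compact gauge groups -/

section Transport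

variable {d N : ℕ} {G H : Type*} [Group G] [TopologicalSpace G] [IsTopologicalGroup G]
  [CompactSpace G] [MeasurableSpace G] [BorelSpace G]
  [Group H] [TopologicalSpace H] [IsTopologicalGroup H] [CompactSpace H] [MeasurableSpace H]
  [BorelSpace H]

omit [TopologicalSpace G] [IsTopologicalGroup G] [CompactSpace G] [MeasurableSpace G] [BorelSpace G]
  [TopologicalSpace H] [IsTopologicalGroup H] [CompactSpace H] [MeasurableSpace H] [BorelSpace H] in
/-- Plaquette holonomies on the torus are transported by a group homomorphism. [folklore] -/
theorem plaquetteHolonomy_comp_mulEquiv {L : ℕ} (e : G ≃* H) (U : GaugeConfig d L G)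
    (y : Site d L) (i j : Fin d) :
    plaquetteHolonomy (fun x => e (U x)) y i j = e (plaquetteHolonomy U y i j) := by
  simp [plaquetteHolonomy, map_mul, map_inv]

omit [TopologicalSpace G] [IsTopologicalGroup G] [CompactSpace G] [MeasurableSpace G] [BorelSpace G]
  [TopologicalSpace H] [IsTopologicalGroup H] [CompactSpace H] [MeasurableSpace H] [BorelSpace H] in
/-- Plaquette holonomies on `ℤ^d` are transported by a group homomorphism. [folklore] -/
theorem plaquette_comp_mulEquiv (e : G ≃* H) (U : ZdGaugeConfig d G)
    (y : Literature.Probability.LatticeModels.Site d) (i j : Fin d) :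
    ZdGaugeConfig.plaquette (fun x => e (U x)) y i j = e (U.plaquette y i j) := by
  simp [ZdGaugeConfig.plaquette, map_mul, map_inv]

omit [TopologicalSpace G] [IsTopologicalGroup G] [CompactSpace G] [MeasurableSpace G] [BorelSpace G]
  [TopologicalSpace H] [IsTopologicalGroup H] [CompactSpace H] [MeasurableSpace H] [BorelSpace H] in
/-- The torus Wilson action is transported along an isomorphism of models. [folklore] -/
theorem wilsonAction_comp_mulEquiv {L : ℕ} [NeZero L] (e : G ≃* H)
    {ρ : G →* Matrix (Fin N) (Fin N) ℂ} {ρ' : H →* Matrix (Fin N) (Fin N) ℂ}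
    (hρ : ∀ g, ρ g = ρ' (e g)) (U : GaugeConfig d L G) :
    wilsonAction ρ' (fun x => e (U x)) = wilsonAction ρ U := by
  unfold wilsonAction
  refine Finset.sum_congr rfl fun p _ => ?_
  rw [plaquetteHolonomy_comp_mulEquiv, ← hρ]

omit [TopologicalSpace G] [IsTopologicalGroup G] [CompactSpace G] [MeasurableSpace G] [BorelSpace G]
  [TopologicalSpace H] [IsTopologicalGroup H] [CompactSpace H] [MeasurableSpace H] [BorelSpace H] in
/-- The free-boundary Wilson action is transported along an isomorphism of models. [folklore] -/
theorem zdWilsonAction_comp_mulEquiv (e : G ≃* H)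
    {ρ : G →* Matrix (Fin N) (Fin N) ℂ} {ρ' : H →* Matrix (Fin N) (Fin N) ℂ}
    (hρ : ∀ g, ρ g = ρ' (e g)) (Λ : Finset (Literature.Probability.LatticeModels.Site d))
    (U : ZdGaugeConfig d G) :
    zdWilsonAction ρ' Λ (fun x => e (U x)) = zdWilsonAction ρ Λ U := by
  unfold zdWilsonAction
  refine Finset.sum_congr rfl fun p _ => ?_
  rw [plaquette_comp_mulEquiv, ← hρ]

omit [TopologicalSpace G] [IsTopologicalGroup G] [CompactSpace G] [MeasurableSpace G] [BorelSpace G]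
  [TopologicalSpace H] [IsTopologicalGroup H] [CompactSpace H] [MeasurableSpace H] [BorelSpace H] in
/-- The plaquette observables are transported along an isomorphism of models. [folklore] -/
theorem zdPlaquetteObs_comp_mulEquiv (e : G ≃* H)
    {ρ : G →* Matrix (Fin N) (Fin N) ℂ} {ρ' : H →* Matrix (Fin N) (Fin N) ℂ}
    (hρ : ∀ g, ρ g = ρ' (e g)) (y : Literature.Probability.LatticeModels.Site d) (i j : Fin d)
    (U : ZdGaugeConfig d G) :
    zdPlaquetteObs ρ' y i j (fun x => e (U x)) = zdPlaquetteObs ρ y i j U := by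
  unfold zdPlaquetteObs
  rw [plaquette_comp_mulEquiv, ← hρ]

omit [Group G] [TopologicalSpace G] [IsTopologicalGroup G] [CompactSpace G] [BorelSpace G]
  [Group H] [TopologicalSpace H] [IsTopologicalGroup H] [CompactSpace H] [BorelSpace H] in
/-- `withDensity` is transported along a measurable equivalence:
`e_* ((w ∘ e) μ) = w (e_* μ)`. [folklore] -/
theorem map_withDensity_comp_measurableEquiv {α β : Type*} [MeasurableSpace α] [MeasurableSpace β]
    (μ : Measure α) (e : α ≃ᵐ β) (w : β → ℝ≥0∞) :
    (μ.withDensity (w ∘ e)).map e = (μ.map e).withDensity w := by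
  ext s hs
  rw [Measure.map_apply e.measurable hs, withDensity_apply _ (e.measurable hs),
    withDensity_apply _ hs, Measure.restrict_map e.measurable hs, lintegral_map_equiv]
  rfl

variable [SecondCountableTopology H]

/-- **Haar measure is transported** along a continuous isomorphism of compact groups:
`e_* (Haar_G) = Haar_H` (left invariance of the push-forward and uniqueness of the Haar
probability measure). [folklore] -/
theorem map_haarProbability_of_mulEquiv (e : G ≃* H) (he : Continuous e) :
    (haarProbability G).map e = haarProbability H := by
  have hmeas : Measurable e := he.measurable
  set μ := (haarProbability G).map e with hμ
  haveI : IsProbabilityMeasure μ := Measure.isProbabilityMeasure_map hmeas.aemeasurable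
  haveI : μ.IsMulLeftInvariant := by
    refine ⟨fun h => ?_⟩
    obtain ⟨g, rfl⟩ := e.surjective h
    rw [hμ, Measure.map_map (measurable_const_mul _) hmeas]
    have : (fun x => e g * x) ∘ e = e ∘ fun x => g * x := by funext x; simp
    rw [this, ← Measure.map_map hmeas (measurable_const_mul g), map_mul_left_eq_self]
  have h := Measure.haarMeasure_unique μ (⊤ : TopologicalSpace.PositiveCompacts H)
  rw [h, TopologicalSpace.PositiveCompacts.coe_top, measure_univ, one_smul]
  rfl

/-- **The infinite Haar product is transported**: `E_* dg_∞^G = dg_∞^H` for the configuration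
map `E U = e ∘ U` (Mathlib `Measure.infinitePi_map_pi`). [folklore] -/
theorem map_zdHaar_of_mulEquiv (e : G ≃* H) (he : Continuous e) :
    (zdHaar d G).map (fun (U : ZdGaugeConfig d G) (x : ZdEdge d) => e (U x)) = zdHaar d H := by
  rw [zdHaar, zdHaar, Measure.infinitePi_map_pi (μ := fun _ : ZdEdge d => haarProbability G)
    (fun _ => he.measurable)]
  simp only [map_haarProbability_of_mulEquiv e he]

/-- The finite Haar product over the torus links is transported (Mathlib `measurePreserving_pi`).
[folklore] -/
theorem map_pi_haarProbability_of_mulEquiv (e : G ≃* H) (he : Continuous e) (L : ℕ) [NeZero L] :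
    (Measure.pi fun _ : Edge d L => haarProbability G).map
        (fun (U : GaugeConfig d L G) (x : Edge d L) => e (U x)) =
      Measure.pi fun _ : Edge d L => haarProbability H :=
  (measurePreserving_pi (fun _ : Edge d L => haarProbability G)
    (fun _ : Edge d L => haarProbability H)
    (fun _ => ⟨he.measurable, map_haarProbability_of_mulEquiv e he⟩)).map_eq

variable {ρ : G →* Matrix (Fin N) (Fin N) ℂ} {ρ' : H →* Matrix (Fin N) (Fin N) ℂ}

/-- **The torus Wilson states are transported** along an isomorphism of models `(G, ρ) ≅ (H, ρ')`.
[folklore] -/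
theorem map_wilsonMeasure_of_mulEquiv (e : G ≃* H) (he : Continuous e) (hes : Continuous e.symm)
    (hρ : ∀ g, ρ g = ρ' (e g)) (β : ℝ) (L : ℕ) [NeZero L] :
    (wilsonMeasure ρ β).map (fun (U : GaugeConfig d L G) (x : Edge d L) => e (U x)) =
      wilsonMeasure (d := d) (L := L) ρ' β := by
  let eM : G ≃ᵐ H :=
    { toEquiv := e.toEquiv, measurable_toFun := he.measurable, measurable_invFun := hes.measurable }
  let E : GaugeConfig d L G ≃ᵐ GaugeConfig d L H := MeasurableEquiv.piCongrRight fun _ => eM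
  have hE : (E : GaugeConfig d L G → GaugeConfig d L H) = fun U x => e (U x) := rfl
  have hdens : ((Measure.pi fun _ : Edge d L => haarProbability G).withDensity fun U =>
        ENNReal.ofReal (Real.exp (-β * wilsonAction ρ U))).map (fun U x => e (U x)) =
      (Measure.pi fun _ : Edge d L => haarProbability H).withDensity fun U =>
        ENNReal.ofReal (Real.exp (-β * wilsonAction ρ' U)) := by
    have hcomp : (fun U : GaugeConfig d L G => ENNReal.ofReal (Real.exp (-β * wilsonAction ρ U))) =
        (fun U : GaugeConfig d L H => ENNReal.ofReal (Real.exp (-β * wilsonAction ρ' U))) ∘ E := by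
      funext U
      simp only [Function.comp_apply, hE, wilsonAction_comp_mulEquiv e hρ]
    rw [hcomp, ← hE, map_withDensity_comp_measurableEquiv _ E, hE,
      map_pi_haarProbability_of_mulEquiv e he]
  have hZ : ((Measure.pi fun _ : Edge d L => haarProbability G).withDensity fun U =>
        ENNReal.ofReal (Real.exp (-β * wilsonAction ρ U))) Set.univ =
      ((Measure.pi fun _ : Edge d L => haarProbability H).withDensity fun U =>
        ENNReal.ofReal (Real.exp (-β * wilsonAction ρ' U))) Set.univ := by
    rw [← hdens, ← hE, Measure.map_apply E.measurable MeasurableSet.univ, Set.preimage_univ]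
  unfold wilsonMeasure partitionFunction wilsonWeight
  rw [Measure.map_smul, hdens, hZ]

/-- **`Sweep1`'s periodic states are transported** along an isomorphism of models. [folklore] -/
theorem map_periodicState_of_mulEquiv (e : G ≃* H) (he : Continuous e) (hes : Continuous e.symm)
    (hρ : ∀ g, ρ g = ρ' (e g)) (β : ℝ) (L : ℕ) [NeZero L] :
    (periodicState ρ β L).map (fun (U : ZdGaugeConfig d G) (x : ZdEdge d) => e (U x)) =
      periodicState (d := d) ρ' β L := by
  have h1 : Measurable fun (U : ZdGaugeConfig d G) (x : ZdEdge d) => e (U x) :=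
    measurable_pi_lambda _ fun x => he.measurable.comp (measurable_pi_apply x)
  have h2 : Measurable fun (U : GaugeConfig d L G) (x : Edge d L) => e (U x) :=
    measurable_pi_lambda _ fun x => he.measurable.comp (measurable_pi_apply x)
  have hcomm : (fun (U : ZdGaugeConfig d G) (x : ZdEdge d) => e (U x)) ∘
      (ZdGaugeConfig.ofTorus : GaugeConfig d L G → ZdGaugeConfig d G) =
      ZdGaugeConfig.ofTorus ∘ fun (U : GaugeConfig d L G) (x : Edge d L) => e (U x) := rfl
  have hoG : Measurable (ZdGaugeConfig.ofTorus : GaugeConfig d L G → ZdGaugeConfig d G) :=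
    measurable_torusLift L
  have hoH : Measurable (ZdGaugeConfig.ofTorus : GaugeConfig d L H → ZdGaugeConfig d H) :=
    measurable_torusLift L
  unfold periodicState
  rw [Measure.map_map h1 hoG, hcomm, ← Measure.map_map hoH h2, map_wilsonMeasure_of_mulEquiv e he hes hρ]

/-- **`Sweep1`'s free-boundary Wilson measures are transported** along an isomorphism of models.
[folklore] -/
theorem map_zdWilsonMeasure_of_mulEquiv (e : G ≃* H) (he : Continuous e) (hes : Continuous e.symm)
    (hρ : ∀ g, ρ g = ρ' (e g)) (β : ℝ) (Λ : Finset (Literature.Probability.LatticeModels.Site d)) :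
    (zdWilsonMeasure ρ β Λ).map (fun (U : ZdGaugeConfig d G) (x : ZdEdge d) => e (U x)) =
      zdWilsonMeasure (d := d) ρ' β Λ := by
  let eM : G ≃ᵐ H :=
    { toEquiv := e.toEquiv, measurable_toFun := he.measurable, measurable_invFun := hes.measurable }
  let E : ZdGaugeConfig d G ≃ᵐ ZdGaugeConfig d H := MeasurableEquiv.piCongrRight fun _ => eM
  have hE : (E : ZdGaugeConfig d G → ZdGaugeConfig d H) = fun U x => e (U x) := rfl
  have hdens : ((zdHaar d G).withDensity fun U =>
        ENNReal.ofReal (Real.exp (-β * zdWilsonAction ρ Λ U))).map (fun U x => e (U x)) =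
      (zdHaar d H).withDensity fun U => ENNReal.ofReal (Real.exp (-β * zdWilsonAction ρ' Λ U)) := by
    have hcomp : (fun U : ZdGaugeConfig d G =>
        ENNReal.ofReal (Real.exp (-β * zdWilsonAction ρ Λ U))) =
        (fun U : ZdGaugeConfig d H => ENNReal.ofReal (Real.exp (-β * zdWilsonAction ρ' Λ U))) ∘ E := by
      funext U
      simp only [Function.comp_apply, hE, zdWilsonAction_comp_mulEquiv e hρ]
    rw [hcomp, ← hE, map_withDensity_comp_measurableEquiv _ E, hE, map_zdHaar_of_mulEquiv e he]
  have hZ : ((zdHaar d G).withDensity fun U =>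
        ENNReal.ofReal (Real.exp (-β * zdWilsonAction ρ Λ U))) Set.univ =
      ((zdHaar d H).withDensity fun U =>
        ENNReal.ofReal (Real.exp (-β * zdWilsonAction ρ' Λ U))) Set.univ := by
    rw [← hdens, ← hE, Measure.map_apply E.measurable MeasurableSet.univ, Set.preimage_univ]
  unfold zdWilsonMeasure zdPartitionFunction zdWilsonWeight
  rw [Measure.map_smul, hdens, hZ]

end Transport

/-! ### The named fact `shenZhuZhu_strongCoupling` from `shen_zhu_zhu` -/

section Main

variable {d N : ℕ} {G : Type*} [Group G] [TopologicalSpace G] [IsTopologicalGroup G]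
  [CompactSpace G] [MeasurableSpace G] [BorelSpace G] (ρ : G →* Matrix (Fin N) (Fin N) ℂ)

omit [IsTopologicalGroup G] [MeasurableSpace G] [BorelSpace G] in
/-- **An `SU(N)` model is isomorphic to the concrete one**: for `IsSpecialUnitaryModel ρ` there
is an isomorphism of topological groups `e : G ≃* Matrix.specialUnitaryGroup (Fin N) ℂ` with
`ρ = fundamentalRep ∘ e` (a continuous bijection of a compact space onto a Hausdorff space is a
homeomorphism). [folklore] -/
theorem IsSpecialUnitaryModel.exists_mulEquiv (hρ : IsSpecialUnitaryModel ρ) :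
    ∃ e : G ≃* Matrix.specialUnitaryGroup (Fin N) ℂ,
      (∀ g, ρ g = fundamentalRep (Fin N) (e g)) ∧ Continuous e ∧ Continuous e.symm := by
  have hmem : ∀ g, ρ g ∈ Matrix.specialUnitaryGroup (Fin N) ℂ := fun g => by
    have : ρ g ∈ Set.range ρ := ⟨g, rfl⟩
    rw [hρ.2.2] at this
    exact this
  let f : G →* Matrix.specialUnitaryGroup (Fin N) ℂ :=
    { toFun := fun g => ⟨ρ g, hmem g⟩
      map_one' := Subtype.ext (by simp)
      map_mul' := fun g h => Subtype.ext (by simp) }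
  have hf : Function.Bijective f := by
    refine ⟨fun g h hgh => hρ.2.1 (by simpa [f] using congrArg Subtype.val hgh), fun U => ?_⟩
    have hU : (U : Matrix (Fin N) (Fin N) ℂ) ∈ Set.range ρ := by rw [hρ.2.2]; exact U.2
    obtain ⟨g, hg⟩ := hU
    exact ⟨g, Subtype.ext hg⟩
  let e : G ≃* Matrix.specialUnitaryGroup (Fin N) ℂ := MulEquiv.ofBijective f hf
  have hec : Continuous e := Continuous.subtype_mk hρ.1 _
  let eh : G ≃ₜ Matrix.specialUnitaryGroup (Fin N) ℂ :=
    Continuous.homeoOfEquivCompactToT2 (f := e.toEquiv) hec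
  exact ⟨e, fun g => rfl, hec, eh.continuous_symm⟩

/-- **The named fact `shenZhuZhu_strongCoupling` follows from the named fact `shen_zhu_zhu`**
(both: Shen–Zhu–Zhu, *A stochastic analysis approach to lattice Yang–Mills at strong coupling*,
CMP 400 (2023) 805, arXiv:2204.12737, Assumption 1.1, Thm. 1.2, Rem. 1.3, Cor. 1.6). For the
concrete group this is `shenZhuZhu_strongCoupling_fundamentalRep`; an abstract `SU(N)` model is
isomorphic to the concrete one (`IsSpecialUnitaryModel.exists_mulEquiv`) and the periodic
states, the free-boundary states, the translations, the plaquette observables and the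
covariances are transported along the induced equivalence of configuration spaces
(`map_periodicState_of_mulEquiv`, `map_zdWilsonMeasure_of_mulEquiv`). [cite: arXiv220412737, Thm. 1.2, Rem. 1.3, Cor. 1.6] -/
theorem shenZhuZhu_strongCoupling_of_shen_zhu_zhu (h : shen_zhu_zhu d N) :
    shenZhuZhu_strongCoupling (d := d) ρ := by
  intro hN hρ hd β hβ
  classical
  -- the concrete model and the isomorphism
  haveI : SecondCountableTopology (Matrix (Fin N) (Fin N) ℂ) :=
    inferInstanceAs (SecondCountableTopology (Fin N → Fin N → ℂ))
  haveI : SecondCountableTopology (Matrix.specialUnitaryGroup (Fin N) ℂ) :=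
    Topology.IsEmbedding.subtypeVal.secondCountableTopology
  haveI : SecondCountableTopology G := IsSpecialUnitaryModel.secondCountableTopology ρ hρ
  obtain ⟨e, he, hec, hesc⟩ := IsSpecialUnitaryModel.exists_mulEquiv ρ hρ
  obtain ⟨μ, hμ, hconv, htrans, huniq, C, m, hm, hcov⟩ :=
    shenZhuZhu_strongCoupling_fundamentalRep h hN (TorusAreaLaw.isSpecialUnitaryModel_fundamentalRep N) hd hβ
  -- the induced equivalence of configuration spaces
  let eM : G ≃ᵐ Matrix.specialUnitaryGroup (Fin N) ℂ :=
    { toEquiv := e.toEquiv, measurable_toFun := hec.measurable, measurable_invFun := hesc.measurable }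
  let E : ZdGaugeConfig d G ≃ᵐ ZdGaugeConfig d (Matrix.specialUnitaryGroup (Fin N) ℂ) :=
    MeasurableEquiv.piCongrRight fun _ => eM
  have hE : (E : ZdGaugeConfig d G → ZdGaugeConfig d (Matrix.specialUnitaryGroup (Fin N) ℂ)) =
      fun U x => e (U x) := rfl
  have hEsc : Continuous E.symm :=
    continuous_pi fun x => hesc.comp (continuous_apply x)
  have hEc : Continuous E := continuous_pi fun x => hec.comp (continuous_apply x)
  haveI : IsProbabilityMeasure (μ.map E.symm) :=
    Measure.isProbabilityMeasure_map E.symm.measurable.aemeasurable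
  refine ⟨μ.map E.symm, inferInstance, ?_, ?_, ?_, C, m, hm, ?_⟩
  · -- convergence of the periodic states
    intro f hf hfb
    have hf' : Continuous (f ∘ E.symm) := hf.comp hEsc
    have hfb' : Bornology.IsBounded (Set.range (f ∘ E.symm)) :=
      hfb.subset (Set.range_comp_subset_range _ _)
    have h1 := hconv (f ∘ E.symm) hf' hfb'
    have heq : ∀ L : ℕ, ∫ U, f U ∂(periodicState ρ β (L + 1)) =
        ∫ U, f (E.symm U) ∂(periodicState (fundamentalRep (Fin N)) β (L + 1)) := fun L => by
      rw [← map_periodicState_of_mulEquiv e hec hesc he β (L + 1), ← hE, integral_map_equiv]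
      simp only [MeasurableEquiv.symm_apply_apply]
    rw [integral_map_equiv]
    simp_rw [heq]
    simpa only [Function.comp_apply] using h1
  · -- translation invariance
    intro a
    have hcomm : (ZdGaugeConfig.translate a : ZdGaugeConfig d G → ZdGaugeConfig d G) ∘ E.symm =
        E.symm ∘ ZdGaugeConfig.translate a := rfl
    rw [Measure.map_map (measurable_translate a) E.symm.measurable, hcomm,
      ← Measure.map_map E.symm.measurable (measurable_translate a), htrans a]
  · -- uniqueness: a free-boundary limit of the abstract model is one of the concrete model
    intro μ' hμ'
    obtain ⟨hprob', φ, hφ, hlim'⟩ := hμ'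
    have hlim : IsInfiniteVolumeLimit (fundamentalRep (Fin N)) β (μ'.map E) := by
      haveI : IsProbabilityMeasure (μ'.map E) :=
        Measure.isProbabilityMeasure_map E.measurable.aemeasurable
      refine ⟨inferInstance, φ, hφ, fun f hf hfb => ?_⟩
      have hf' : Continuous (f ∘ E) := hf.comp hEc
      have hfb' : Bornology.IsBounded (Set.range (f ∘ E)) :=
        hfb.subset (Set.range_comp_subset_range _ _)
      have h1 := hlim' (f ∘ E) hf' hfb'
      have heq : ∀ k : ℕ, zdExpect (fundamentalRep (Fin N)) β (box d (φ k)) f =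
          zdExpect ρ β (box d (φ k)) (f ∘ E) := fun k => by
        unfold zdExpect
        rw [← map_zdWilsonMeasure_of_mulEquiv e hec hesc he β (box d (φ k)), ← hE,
          integral_map_equiv]
        rfl
      rw [integral_map_equiv]
      simp_rw [heq]
      simpa only [Function.comp_apply] using h1
    have hμ'E : μ'.map E = μ := huniq _ hlim
    rw [← hμ'E, MeasurableEquiv.map_symm_map]
  · -- exponential decay of plaquette–plaquette covariances
    have hobs : ∀ (z : Literature.Probability.LatticeModels.Site d) (i' j' : Fin d),
        zdPlaquetteObs ρ z i' j' ∘ E.symm = zdPlaquetteObs (fundamentalRep (Fin N)) z i' j' := by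
      intro z i' j'
      funext V
      rw [Function.comp_apply, ← zdPlaquetteObs_comp_mulEquiv e he z i' j' (E.symm V)]
      change zdPlaquetteObs (fundamentalRep (Fin N)) z i' j' (E (E.symm V)) = _
      rw [MeasurableEquiv.apply_symm_apply]
    intro x y i j k l hij hkl
    rw [covariance_map_equiv, hobs, hobs]
    exact hcov x y i j k l hij hkl

/-- **`shenZhuZhu_strongCoupling` from the one-link Poincaré inequality on `SU(N)`**: composing
with the tree's reduction `shen_zhu_zhu_of_haarPoincare` (`LatticeGaugeDobrushinPoincare`), the
named fact of `Sweep1` follows from the Poincaré inequality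
`Var_{ν_B}(ψ) ≤ M² / (N (1/2 - ‖B‖_op))` for the Gibbs-tilted Haar measures
`ν_B ∝ exp(N Re tr(g B)) dg` on `SU(N)`, `‖B‖_op < 1/2`, and `M`-Lipschitz `ψ` — the Bakry–Émery
bound `Ric - Hess ≥ N(1/2 - ‖B‖_op)` of Shen–Zhu–Zhu (CMP 400 (2023); arXiv:2204.12737v1 Lemma 4.1,
(4.7)–(4.8), Cor. 4.4 (4.11)), which is the only part of the cited theorem not formalised in the
tree. [cite: arXiv220412737, Lemma 4.1, (4.7)–(4.8), Cor. 4.4 (4.11), Thm. 1.2, Cor. 1.6] -/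
theorem shenZhuZhu_strongCoupling_of_haarPoincare
    (hLP : 2 ≤ N → ∀ B : Matrix (Fin N) (Fin N) ℂ, matrixOpNorm B < 1 / 2 →
      ∀ (ψ : Matrix.specialUnitaryGroup (Fin N) ℂ → ℝ) (M : ℝ), 0 ≤ M →
        (∀ a b, |ψ a - ψ b| ≤ M * suFrobDist a b) →
        Var[ψ; (haarProbability (Matrix.specialUnitaryGroup (Fin N) ℂ)).tilted
            fun g => (N : ℝ) * ((g : Matrix (Fin N) (Fin N) ℂ) * B).trace.re] ≤
          M ^ 2 / ((N : ℝ) * (1 / 2 - matrixOpNorm B))) :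
    shenZhuZhu_strongCoupling (d := d) ρ :=
  shenZhuZhu_strongCoupling_of_shen_zhu_zhu ρ (shen_zhu_zhu_of_haarPoincare hLP)

end Main

end Literature.MathematicalPhysics.QuantumFieldTheory
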